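import Mathlib

/-!
# Rank at one point ⇒ the image contains an open set (seat p5; Mathlib only)

Blind re-derivation cell `pub-hodge-repro`, seat `p5`.  The kernel-checkable half of ROUTE-C 13.3(iv)
«rank ⇒ dominance» (R5 step (4)): if `f = (f₁, …, f_g) : 𝔹^p → ℂ^g` has `rank df_z = g` at ONE point `z` —
in the cell's vocabulary: the `g` differential covectors `(∂ᵢ f_l(z))ᵢ` are linearly independent at `z`, which
is what `lemmaW_iter` / `lemmaW_generic` produce for the pulled-back eigenforms — then `f` maps every
neighbourhood of `z` onto a neighbourhood of `f z`; in particular `f(S′)` contains a non-empty open set.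
Everything is Mathlib's inverse-function theorem (`HasStrictFDerivAt.map_nhds_eq_of_surj`) plus linear algebra.

* `surjective_of_linearIndependent_rows` — a linear map `L : ℂ^p → ℂ^g` whose `g` row covectors
  `i ↦ L(eᵢ)_l` are linearly independent is surjective (rank of the matrix = `g`);
* `map_nhds_eq_of_linearIndependent_rows` — `f : ℂ^p → ℂ^g` analytic at `z` with the rows of `df_z`
  independent: `map f (𝓝 z) = 𝓝 (f z)`; `image_mem_nhds_of_linearIndependent_rows`: `f '' U ∈ 𝓝 (f z)` for
  every `U ∈ 𝓝 z`; `exists_isOpen_subset_image…`: an open set around `f z` inside `f '' U`;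
* `dcov h z = fun i => fderiv ℂ h z (Pi.single i 1)` — the covector of `dh` at `z`; `dcov_eq_row_fderiv_pi`;
  `image_mem_nhds_of_linearIndependent_dcov` — `g` functions `h l` analytic at `z` with
  `LinearIndependent ℂ (fun l => dcov (h l) z)` ⇒ `(h₁, …, h_g)` maps `U ∈ 𝓝 z` onto a neighbourhood of the
  image point; `exists_isOpen_subset_image_of_linearIndependent_dcov` the open-set form.

What stays on paper (ROUTE-C 13.3(iv), second half): that `f(S′)`, a closed irreducible subvariety of `A′`
(properness / Remmert) of dimension `≥ rank df_z = dim A′`, is all of `A′`; and 13.2(a)'s identification of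
the pulled-back eigenforms with the `dh_l`.

Nothing here says anything about the status of the Hodge conjecture for CM abelian varieties.
-/

set_option autoImplicit false

noncomputable section

namespace HodgeRepro.BallGen

namespace Subm

open Filter Topology Module

/-! ### Linear algebra: independent rows ⇒ surjective -/

/-- The `l`-th row covector of a linear map `L : ℂ^p → ℂ^g`: `i ↦ L(eᵢ)_l`. -/
def rowCov {p g : ℕ} (L : (Fin p → ℂ) →ₗ[ℂ] (Fin g → ℂ)) (l : Fin g) : Fin p → ℂ :=
  fun i => L (Pi.single i 1) l

/-- The row covectors are the rows of the matrix of `L`. -/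
theorem rowCov_eq_row {p g : ℕ} (L : (Fin p → ℂ) →ₗ[ℂ] (Fin g → ℂ)) :
    rowCov L = (LinearMap.toMatrix' L).row := by
  ext l i
  simp only [rowCov, Matrix.row, LinearMap.toMatrix'_apply]

/-- **Independent rows ⇒ surjective.**  If the `g` row covectors of `L : ℂ^p → ℂ^g` are linearly independent
then `L` is surjective (the rank of its matrix is `g`). -/
theorem range_eq_top_of_linearIndependent_rows {p g : ℕ} (L : (Fin p → ℂ) →ₗ[ℂ] (Fin g → ℂ))
    (h : LinearIndependent ℂ (rowCov L)) : LinearMap.range L = ⊤ := by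
  have hrank : (LinearMap.toMatrix' L).rank = g := by
    rw [Matrix.rank_eq_finrank_span_row, ← rowCov_eq_row, finrank_span_eq_card h, Fintype.card_fin]
  have hL : (LinearMap.toMatrix' L).mulVecLin = L := by
    rw [← Matrix.toLin'_apply', Matrix.toLin'_toMatrix']
  apply Submodule.eq_top_of_finrank_eq
  rw [Module.finrank_fin_fun]
  calc finrank ℂ (LinearMap.range L) = (LinearMap.toMatrix' L).rank := by
        unfold Matrix.rank
        rw [hL]
    _ = g := hrank

/-- The function form of `range_eq_top_of_linearIndependent_rows`. -/
theorem surjective_of_linearIndependent_rows {p g : ℕ} (L : (Fin p → ℂ) →ₗ[ℂ] (Fin g → ℂ))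
    (h : LinearIndependent ℂ (rowCov L)) : Function.Surjective L :=
  LinearMap.range_eq_top.mp (range_eq_top_of_linearIndependent_rows L h)

/-! ### Analysis: rank `g` at a point ⇒ open image near the point -/

/-- **Open mapping at a point of full rank.**  If `f : ℂ^p → ℂ^g` is analytic at `z` and the `g` row covectors
of `df_z` are linearly independent, then `f` maps the neighbourhood filter of `z` onto that of `f z`. -/
theorem map_nhds_eq_of_linearIndependent_rows {p g : ℕ} {f : (Fin p → ℂ) → (Fin g → ℂ)} {z : Fin p → ℂ}
    (hf : AnalyticAt ℂ f z) (h : LinearIndependent ℂ (rowCov (fderiv ℂ f z : (Fin p → ℂ) →ₗ[ℂ] (Fin g → ℂ)))) :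
    map f (𝓝 z) = 𝓝 (f z) :=
  hf.hasStrictFDerivAt.map_nhds_eq_of_surj (range_eq_top_of_linearIndependent_rows _ h)

/-- Every neighbourhood of a point of full rank is mapped onto a neighbourhood of its image. -/
theorem image_mem_nhds_of_linearIndependent_rows {p g : ℕ} {f : (Fin p → ℂ) → (Fin g → ℂ)} {z : Fin p → ℂ}
    (hf : AnalyticAt ℂ f z) (h : LinearIndependent ℂ (rowCov (fderiv ℂ f z : (Fin p → ℂ) →ₗ[ℂ] (Fin g → ℂ))))
    {U : Set (Fin p → ℂ)} (hU : U ∈ 𝓝 z) : f '' U ∈ 𝓝 (f z) := by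
  rw [← map_nhds_eq_of_linearIndependent_rows hf h]
  exact image_mem_map hU

/-- The image of a neighbourhood of a point of full rank contains a non-empty open set. -/
theorem exists_isOpen_subset_image_of_linearIndependent_rows {p g : ℕ} {f : (Fin p → ℂ) → (Fin g → ℂ)}
    {z : Fin p → ℂ} (hf : AnalyticAt ℂ f z)
    (h : LinearIndependent ℂ (rowCov (fderiv ℂ f z : (Fin p → ℂ) →ₗ[ℂ] (Fin g → ℂ))))
    {U : Set (Fin p → ℂ)} (hU : U ∈ 𝓝 z) : ∃ V : Set (Fin g → ℂ), IsOpen V ∧ f z ∈ V ∧ V ⊆ f '' U :=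
  let ⟨V, hVU, hVo, hzV⟩ := mem_nhds_iff.mp (image_mem_nhds_of_linearIndependent_rows hf h hU)
  ⟨V, hVo, hzV, hVU⟩

/-! ### The `g`-functions form: differential covectors -/

/-- The covector of `dh` at `z`: `i ↦ ∂ᵢ h(z)`. -/
def dcov {p : ℕ} (h : (Fin p → ℂ) → ℂ) (z : Fin p → ℂ) : Fin p → ℂ :=
  fun i => fderiv ℂ h z (Pi.single i 1)

/-- The differential covectors of `h₁, …, h_g` are the row covectors of `d(h₁, …, h_g)`. -/
theorem dcov_eq_rowCov_fderiv_pi {p g : ℕ} (h : Fin g → (Fin p → ℂ) → ℂ) {z : Fin p → ℂ}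
    (hd : ∀ l, DifferentiableAt ℂ (h l) z) :
    (fun l => dcov (h l) z) =
      rowCov (fderiv ℂ (fun w l => h l w) z : (Fin p → ℂ) →ₗ[ℂ] (Fin g → ℂ)) := by
  ext l i
  simp only [dcov, rowCov, ContinuousLinearMap.coe_coe, fderiv_pi hd, ContinuousLinearMap.pi_apply]

/-- **`g` functions of rank `g` at a point map neighbourhoods onto neighbourhoods.**  If `h₁, …, h_g` are
analytic at `z` and their differential covectors `dcov (h l) z` are linearly independent, then
`(h₁, …, h_g)` maps every neighbourhood `U` of `z` onto a neighbourhood of `(h₁ z, …, h_g z)`. -/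
theorem image_mem_nhds_of_linearIndependent_dcov {p g : ℕ} (h : Fin g → (Fin p → ℂ) → ℂ) {z : Fin p → ℂ}
    (ha : ∀ l, AnalyticAt ℂ (h l) z) (hli : LinearIndependent ℂ fun l => dcov (h l) z)
    {U : Set (Fin p → ℂ)} (hU : U ∈ 𝓝 z) : (fun w l => h l w) '' U ∈ 𝓝 fun l => h l z := by
  have hd : ∀ l, DifferentiableAt ℂ (h l) z := fun l => (ha l).differentiableAt
  rw [dcov_eq_rowCov_fderiv_pi h hd] at hli
  exact image_mem_nhds_of_linearIndependent_rows (AnalyticAt.pi ha) hli hU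

/-- The open-set form: an open `V ∋ (h₁ z, …, h_g z)` inside the image of `U`. -/
theorem exists_isOpen_subset_image_of_linearIndependent_dcov {p g : ℕ} (h : Fin g → (Fin p → ℂ) → ℂ)
    {z : Fin p → ℂ} (ha : ∀ l, AnalyticAt ℂ (h l) z) (hli : LinearIndependent ℂ fun l => dcov (h l) z)
    {U : Set (Fin p → ℂ)} (hU : U ∈ 𝓝 z) :
    ∃ V : Set (Fin g → ℂ), IsOpen V ∧ (fun l => h l z) ∈ V ∧ V ⊆ (fun w l => h l w) '' U :=
  let ⟨V, hVU, hVo, hzV⟩ := mem_nhds_iff.mp (image_mem_nhds_of_linearIndependent_dcov h ha hli hU)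
  ⟨V, hVo, hzV, hVU⟩

/-- For an OPEN `U ∋ z` (e.g. the ball) the conclusion needs no filter: `(h₁, …, h_g) '' U` is a
neighbourhood of the image point. -/
theorem image_mem_nhds_of_linearIndependent_dcov_of_isOpen {p g : ℕ} (h : Fin g → (Fin p → ℂ) → ℂ)
    {z : Fin p → ℂ} (ha : ∀ l, AnalyticAt ℂ (h l) z) (hli : LinearIndependent ℂ fun l => dcov (h l) z)
    {U : Set (Fin p → ℂ)} (hUo : IsOpen U) (hz : z ∈ U) : (fun w l => h l w) '' U ∈ 𝓝 fun l => h l z :=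
  image_mem_nhds_of_linearIndependent_dcov h ha hli (hUo.mem_nhds hz)

/-- **The bridge to the covector-field vocabulary.**  If `ω l` is the differential covector field of `h l`
(`ω l w = dcov (h l) w` for every `w`) and the `ω l` are linearly independent AT the point `z` — the output
of `lemmaW_iter` / `lemmaW_generic` for the pulled-back eigenforms — then `(h₁, …, h_g)` maps every
neighbourhood of `z` onto a neighbourhood of the image point. -/
theorem image_mem_nhds_of_linearIndependent_at {p g : ℕ} (h : Fin g → (Fin p → ℂ) → ℂ)
    (ω : Fin g → (Fin p → ℂ) → Fin p → ℂ) (hω : ∀ l w, ω l w = dcov (h l) w) {z : Fin p → ℂ}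
    (ha : ∀ l, AnalyticAt ℂ (h l) z) (hli : LinearIndependent ℂ fun l => ω l z)
    {U : Set (Fin p → ℂ)} (hU : U ∈ 𝓝 z) : (fun w l => h l w) '' U ∈ 𝓝 fun l => h l z := by
  have hz : (fun l => ω l z) = fun l => dcov (h l) z := funext fun l => hω l z
  rw [hz] at hli
  exact image_mem_nhds_of_linearIndependent_dcov h ha hli hU

end Subm

end HodgeRepro.BallGen

end
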